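import Mathlib
import HarnessLib
import Summits.ResolutionOfSingularities.ResolutionOfSingularities.Theorems.WildQuotientsWildQuotientResolutionS1aModelNodeCentre
import Summits.ResolutionOfSingularities.ResolutionOfSingularities.Theorems.WildQuotientsWildQuotientResolutionS1aKillFreeTransport
import Summits.ResolutionOfSingularities.ResolutionOfSingularities.Theorems.WildQuotientsWildQuotientResolutionS1aStubInitialAtlas
import Summits.ResolutionOfSingularities.ResolutionOfSingularities.Theorems.WildQuotientsWildQuotientResolutionS1aLinesKillsIn

/-!
# S1a — K-LOC (α1): the NODE OF AN INVARIANT BASIC OPEN `D(b)` OF A POLYNOMIAL CHART, with the LOCALISED POLYNOMIAL RING `k[x][1/e b]` as its explicit model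

[OURS · L1 W4.5c · lead-1 g16; plan-1 RULING R-F15o (3) design (α1) «every node of the move is a node of the single-support move restricted to Wᵢ ∩ D(∏ hⱼ) — the
existing polynomial free models serve as node data on these basic opens»; consumer = ✓`exists_isAdmissibleCentre_of_modelNode` (point root on `D(b)` through a model
`Φ : DW.B ≃ k[x][1/hh]`), ✓`exists_moveAtlas_of_nodes` (the multi-support move), ✓`FreeModel.exists_cobordantModelEquiv` / ✓`exists_chartFreeModelEquiv` (free models over
the localised base); tools ✓`basicOpenStable`, ✓`sigmaAway`, ✓`exists_trivialGradedRing`, Mathlib `IsLocalization.ringEquivOfRingEquiv`] — NOT statements of the manuscript;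
counted 0; AI-level work, weaker than expert review. Crux stmt-ResolutionOfSingularities-17941 `CyclicQuotientFourfolds`, line `s1a-logminvertex` v13 (`stub_reachLowerInFX`).

Setting: a model `M`, a stable affine chart `O` with a POLYNOMIAL identification `e : Γ(M, O) ≃ k[x_ι]` intertwining `g₀` with a ring automorphism `σ` of `k[x_ι]`, and a
σ-fixed polynomial `hh`; `b = e⁻¹ hh`.
* `actO_symm_eq_of_fixed` — `b` is `G`-invariant (`G = ⟨g₀⟩`), so `D(b)` is the stable affine open ✓`basicOpenStable`;
* ★★ `exists_rootNodeAway` — NODE DATA `DW` on `D(b)` together with a MODEL `Φ : DW.B ≃+* k[x_ι][1/hh]` such that: `Φ ∘ DW.e ∘ (restriction) = (· /1) ∘ e` on `Γ(M, O)`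
  (pin), `conj Φ DW.σ = sigmaAway σ` (the rows of `σ` localised), and the transported grading is TRIVIAL (every element has every degree — the node of a root chart has no
  torus), so the degree hypotheses of the model-node lemmas are free.
-/

set_option linter.dupNamespace false

noncomputable section

open CategoryTheory Limits AlgebraicGeometry TopologicalSpace Topology Opposite MvPolynomial
open Literature.AlgebraicGeometry.Resolution Literature.AlgebraicGeometry.RelativeSpec
open Summit.ResolutionOfSingularities.ResolutionOfSingularities.Theorems.WildQuotientResolution.S1
open Summit.ResolutionOfSingularities.ResolutionOfSingularities.Theorems.WildQuotientResolution.S1.NodeAtlas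
open Summit.ResolutionOfSingularities.ResolutionOfSingularities.Theorems.WildQuotientResolution.S1.ProducerStep
open Summit.ResolutionOfSingularities.ResolutionOfSingularities.Theorems.WildQuotientResolution.S1.NpFrame
open Summit.ResolutionOfSingularities.ResolutionOfSingularities.Theorems.WildQuotientResolution.S1.GoodCharts
open Summit.ResolutionOfSingularities.ResolutionOfSingularities.Theorems.WildQuotientResolution.S1.NodeAway
open Summit.ResolutionOfSingularities.ResolutionOfSingularities.Theorems.WildQuotientResolution.S1.NodeChartAway
open Summit.ResolutionOfSingularities.ResolutionOfSingularities.Theorems.WildQuotientResolution.S1.NodeTransport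
open Summit.ResolutionOfSingularities.ResolutionOfSingularities.Theorems.WildQuotientResolution.S1.BlowupCharts

namespace Summit.ResolutionOfSingularities.ResolutionOfSingularities.Theorems.WildQuotientResolution.S1.GameFrame.GModel

variable {p : ℕ} {X' X₁ : Scheme.{0}} {q : X' ⟶ X₁} {G : Type} [Group G] {ρ : G →* Aut X'} {g₀ : G}

/-- **`e⁻¹hh` is `G`-invariant** when `σ hh = hh`, `e` intertwines `g₀` with `σ` and `G = ⟨g₀⟩`. -/
theorem actO_symm_eq_of_fixed (hG : ∀ g : G, g ∈ Subgroup.zpowers g₀) (M : GModel p q G ρ g₀) (O : M.act.StableAffineOpens)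
    {k : Type} [Field k] {ι : Type} (e : Γ(M.V, O.1) ≃+* MvPolynomial ι k) (σ : MvPolynomial ι k ≃+* MvPolynomial ι k)
    (hact : ∀ t : Γ(M.V, O.1), actOEquiv M.act O g₀ t = e.symm (σ (e t))) (hh : MvPolynomial ι k) (hσh : σ hh = hh) :
    ∀ g : G, actO M.act O g (e.symm hh) = e.symm hh := by
  have hfix₀ : (M.act.aut g₀⁻¹).hom.appLE O.1 O.1 (O.2.1 g₀⁻¹).ge (e.symm hh) = e.symm hh := by
    change actOEquiv M.act O g₀ (e.symm hh) = e.symm hh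
    rw [hact, e.apply_symm_apply, hσh]
  intro g
  exact appLE_aut_eq_self_of_mem_zpowers M.act O.1 O.2.1 hfix₀ (by rw [Subgroup.zpowers_inv]; exact hG g⁻¹)

set_option maxHeartbeats 1600000 in
/-- ★★ **THE NODE OF `D(b)` WITH ITS LOCALISED POLYNOMIAL MODEL.** See the module docstring.
[OURS · L1 W4.5c · K-LOC (α1); NOT a statement of the manuscript] -/
theorem exists_rootNodeAway (hG : ∀ g : G, g ∈ Subgroup.zpowers g₀) (M : GModel p q G ρ g₀) (O : M.act.StableAffineOpens) (hO : IsAffineOpen O.1)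
    {k : Type} [Field k] {ι : Type} [Fintype ι] [DecidableEq ι] (e : Γ(M.V, O.1) ≃+* MvPolynomial ι k) (σ : MvPolynomial ι k ≃+* MvPolynomial ι k)
    (hact : ∀ t : Γ(M.V, O.1), actOEquiv M.act O g₀ t = e.symm (σ (e t))) (hσp : ∀ a : MvPolynomial ι k, (⇑σ)^[p] a = a)
    (hh : MvPolynomial ι k) (hσh : σ hh = hh) :
    ∃ (DW : NodeData p M.act g₀ (basicOpenStable M.act O hO (actO_symm_eq_of_fixed hG M O e σ hact hh hσh)))
      (Φ : letI := DW.instCommRing; DW.B ≃+* Localization.Away hh),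
      (letI := DW.instCommRing; ∀ t : Γ(M.V, O.1),
        Φ ((DW.e (algebraMap Γ(M.V, O.1) Γ(M.V, M.V.basicOpen (e.symm hh)) t) : ↥(DW.𝒜 0)) : DW.B) =
          algebraMap (MvPolynomial ι k) (Localization.Away hh) (e t)) ∧
      (letI := DW.instCommRing; ∀ x : Localization.Away hh, Φ (DW.σ (Φ.symm x)) = sigmaAway σ hσh x) ∧
      (letI := DW.instCommRing; letI := DW.instGradedRing; ∀ (i : Π j : Fin DW.m, ZMod (DW.r j)) (x : Localization.Away hh), x ∈ mapGrading DW.𝒜 Φ i) := by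
  classical
  set b : Γ(M.V, O.1) := e.symm hh with hbdef
  have hb : ∀ g : G, actO M.act O g b = b := actO_symm_eq_of_fixed hG M O e σ hact hh hσh
  haveI : IsLocalization.Away b Γ(M.V, M.V.basicOpen b) := hO.isLocalization_basicOpen b
  -- the localised polynomial model of `Γ(M, D(b))`
  have H : (Submonoid.powers b).map e.toMonoidHom = Submonoid.powers hh := by
    rw [Submonoid.map_powers]
    exact congrArg Submonoid.powers (e.apply_symm_apply hh)
  let isoW : Γ(M.V, M.V.basicOpen b) ≃+* Localization.Away hh :=
    IsLocalization.ringEquivOfRingEquiv (M := Submonoid.powers b) (T := Submonoid.powers hh) Γ(M.V, M.V.basicOpen b) (Localization.Away hh) e H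
  have hisoW : ∀ t : Γ(M.V, O.1), isoW (algebraMap Γ(M.V, O.1) Γ(M.V, M.V.basicOpen b) t) = algebraMap (MvPolynomial ι k) (Localization.Away hh) (e t) :=
    fun t => IsLocalization.ringEquivOfRingEquiv_eq H t
  -- the trivial grading on the model
  obtain ⟨𝒜W, gr, h𝒜, eB, heB⟩ := exists_trivialGradedRing (Π j : Fin 0, ZMod ((![] : Fin 0 → ℕ) j)) (Localization.Away hh)
  -- tameness of `(k[x][1/hh], trivial, σ_hh)`
  haveI : IsNoetherianRing (Localization.Away hh) := IsLocalization.isNoetherianRing (Submonoid.powers hh) _ inferInstance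
  have hreg : IsRegularRing (Localization.Away hh) := isRegularRing_of_isLocalization (A := MvPolynomial ι k) (Submonoid.powers hh) _
  have hσpW : ∀ y : Localization.Away hh, (⇑(sigmaAway σ hσh))^[p] y = y := sigmaAway_iterate_eq_self σ hσh hσp
  have htame : IsTameNode p (Localization.Away hh) 𝒜W (sigmaAway σ hσh) := by
    refine ⟨inferInstance, hreg, ?_, ?_, ?_, hσpW⟩
    · exact ⟨∅, fun _ h => absurd h (Finset.notMem_empty _), inferInstance⟩
    · refine ⟨∅, eq_top_iff.mpr fun x _ => Subring.subset_closure (Or.inl ?_)⟩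
      rw [h𝒜 0]; exact AddSubgroup.mem_top x
    · intro d' x _; rw [h𝒜 d']; exact AddSubgroup.mem_top _
  -- the intertwining: two ring maps out of the localisation `Γ(M, D(b))` agreeing on `Γ(M, O)`
  have hint : ∀ t' : Γ(M.V, M.V.basicOpen b),
      isoW (actO M.act (basicOpenStable M.act O hO hb) g₀ t') = sigmaAway σ hσh (isoW t') := by
    intro t'
    have key : (isoW.toRingHom.comp (actO M.act (basicOpenStable M.act O hO hb) g₀) : Γ(M.V, M.V.basicOpen b) →+* Localization.Away hh) =
        ((sigmaAway σ hσh).toRingHom.comp isoW.toRingHom : Γ(M.V, M.V.basicOpen b) →+* Localization.Away hh) := by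
      refine IsLocalization.ringHom_ext (Submonoid.powers b) (S := Γ(M.V, M.V.basicOpen b)) (RingHom.ext fun t => ?_)
      change isoW (actO M.act (basicOpenStable M.act O hO hb) g₀ (algebraMap Γ(M.V, O.1) Γ(M.V, M.V.basicOpen b) t)) =
        sigmaAway σ hσh (isoW (algebraMap Γ(M.V, O.1) Γ(M.V, M.V.basicOpen b) t))
      have h1 : actO M.act (basicOpenStable M.act O hO hb) g₀ (algebraMap Γ(M.V, O.1) Γ(M.V, M.V.basicOpen b) t) =
          algebraMap Γ(M.V, O.1) Γ(M.V, M.V.basicOpen b) (actO M.act O g₀ t) := act_basicOpen_algebraMap M.act O hb g₀ t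
      have h2 : actO M.act O g₀ t = e.symm (σ (e t)) := hact t
      rw [h1, h2, hisoW, hisoW, e.apply_symm_apply, sigmaAway_algebraMap]
    exact congrArg (fun φ : Γ(M.V, M.V.basicOpen b) →+* Localization.Away hh => φ t') key
  have hintertwine : ∀ t' : Γ(M.V, (basicOpenStable M.act O hO hb).1),
      (((isoW.trans eB) (actO M.act (basicOpenStable M.act O hO hb) g₀ t') : ↥(𝒜W 0)) : Localization.Away hh) =
        sigmaAway σ hσh (((isoW.trans eB) t' : ↥(𝒜W 0)) : Localization.Away hh) := fun t' => by
    change ((eB (isoW (actO M.act (basicOpenStable M.act O hO hb) g₀ t')) : ↥(𝒜W 0)) : Localization.Away hh) = sigmaAway σ hσh ((eB (isoW t') : ↥(𝒜W 0)) : Localization.Away hh)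
    rw [heB, heB, hint]
  letI : GradedRing 𝒜W := gr
  refine ⟨⟨isAffineOpen_basicOpenStable M.act O hO hb, 0, (![] : Fin 0 → ℕ), Localization.Away hh, 𝒜W, sigmaAway σ hσh, isoW.trans eB, htame,
    hintertwine⟩, RingEquiv.refl _, fun t => ?_, fun x => rfl, fun i x => ?_⟩
  · change ((eB (isoW (algebraMap Γ(M.V, O.1) Γ(M.V, M.V.basicOpen b) t)) : ↥(𝒜W 0)) : Localization.Away hh) = _
    rw [heB, hisoW]
  · rw [mem_mapGrading_iff]
    change x ∈ 𝒜W i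
    rw [h𝒜 i]; exact AddSubgroup.mem_top x

end Summit.ResolutionOfSingularities.ResolutionOfSingularities.Theorems.WildQuotientResolution.S1.GameFrame.GModel

end
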